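import Summits.Ventures.PercRepro.Night2LocalRuleRows

/-!
# PercRepro — the FAIR-SHARE rule: a per-member certificate for the local form (night-2, gen 18)

A second explicit fractional matching for the full family of bottom sets below a rank-`(q+1)` flat `G` with
`d = |E ∖ G| ≤ q`, beside the three-layer rule of `Night2LocalRuleDefs` / `Night2LocalRuleRows`:

* layer 0 as before: a layer-0 member (`|G ∖ cl B| = 1`) takes its whole demand `Φ/(1+d)` from its single
  covering set (`w0`); what is left at a spanning set `S` is `capS S = 1 − k1 S · Φ/(1+d) ≥ 0` (Lemma A);
* every other («thin») member `B` spreads its whole demand `dem B = Φ · localWeight B G` over ALL its spanning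
  supersets `S` (the shadow sets with closure `G` containing `B`, `supSets`), the set `S` receiving the share
  `capS S / piMass π S` relative to a positive weight `π`, where `piMass π S = Σ_{B' thin, B' ⊆ S} π B'` is the
  `π`-mass of the thin members below `S` (`wFair`).

Rows are exact by construction (`sum_wFair_row`: the shares are normalised by `fairIncome π B =
Σ_{S ⊇ B} capS S / piMass π S`).  The column sum at `S` is `1 − capS S + (capS S / piMass π S) ·
Σ_{B thin ⊆ S} dem B / fairIncome π B`, so it is `≤ 1` as soon as every thin member satisfies the
PER-MEMBER inequality `dem B ≤ π B · fairIncome π B` (`sum_wFairRule_col_le`) — no column bookkeeping at all.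
**`localShadowHall_of_fairShare`**: with `|E ∖ G| ≤ q`, that per-member inequality at every thin member gives
(LI_G) at `G`; **`localShadowHall_of_fairShare_dem`** is the instance `π B = dem B / #supSets B` (the
π-normalisation of `proofs/NIGHT-2-local.md` §17(c)), whose condition reads `#supSets B ≤ fairIncome π B`:
the average over the spanning supersets of `B` of `capS S / piMass π S` is at least `1`.
Numerically (proofs/NIGHT-2-g18.md §2) this condition holds with margin `≥ 1.18` on every instance of the rigid
cell `(q−1, q−2)` at `q = 5 … 8` over `GF(3)`, `GF(5)`, `GF(101)`, where every distance-2 rule of the lane dies.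
-/

namespace PercRepro.Shadow

open Finset PerFlat ThmH

variable {α : Type*} [DecidableEq α] {M : Matroid α} [M.Finite]

/-! ## The ingredients -/

open scoped Classical in
/-- The spanning supersets of `B` at `G`: the shadow sets with closure `G` containing `B`. -/
noncomputable def supSets (M : Matroid α) [M.Finite] (q : ℕ) (G B : Finset α) : Finset (Finset α) :=
  (shadowAt M (q + 2) q (Uq M (q + 2) q) G).filter (fun S => B ⊆ S)

open scoped Classical in
/-- The thin members below `G`: the members outside layer 0. -/
noncomputable def thinMembers (M : Matroid α) [M.Finite] (q : ℕ) (G : Finset α) : Finset (Finset α) :=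
  (membersIn M (Uq M (q + 2) q) G).filter (fun B => B ∉ lay0 M q G)

/-- The demand of a member at `G`: `Φ · localWeight`. -/
noncomputable def dem (M : Matroid α) [M.Finite] (q : ℕ) (G B : Finset α) : ℚ :=
  phiQ q * localWeight M B G

open scoped Classical in
/-- The `π`-mass of the thin members below `S`. -/
noncomputable def piMass (M : Matroid α) [M.Finite] (q : ℕ) (G : Finset α) (π : Finset α → ℚ)
    (S : Finset α) : ℚ :=
  ∑ B ∈ (thinMembers M q G).filter (fun B => B ⊆ S), π B

/-- The fair-share income of `B`: `Σ_{S ⊇ B spanning} capS S / piMass π S`. -/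
noncomputable def fairIncome (M : Matroid α) [M.Finite] (q : ℕ) (G : Finset α) (π : Finset α → ℚ)
    (B : Finset α) : ℚ :=
  ∑ S ∈ supSets M q G B, capS M q G S / piMass M q G π S

open scoped Classical in
/-- The fair share of the thin member `B` at `S`. -/
noncomputable def wFair (M : Matroid α) [M.Finite] (q : ℕ) (G : Finset α) (π : Finset α → ℚ)
    (B S : Finset α) : ℚ :=
  if B ∈ thinMembers M q G ∧ S ∈ supSets M q G B then
    dem M q G B * (capS M q G S / piMass M q G π S) / fairIncome M q G π B
  else 0

/-- The fair-share rule: layer 0 plus the fair shares. -/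
noncomputable def wFairRule (M : Matroid α) [M.Finite] (q : ℕ) (G : Finset α) (π : Finset α → ℚ)
    (B S : Finset α) : ℚ :=
  w0 M q G B S + wFair M q G π B S

/-! ## Membership -/

open scoped Classical in
/-- Membership in `supSets`. -/
theorem mem_supSets {q : ℕ} {G B S : Finset α} :
    S ∈ supSets M q G B ↔ S ∈ shadowAt M (q + 2) q (Uq M (q + 2) q) G ∧ B ⊆ S := by
  unfold supSets; rw [Finset.mem_filter]

open scoped Classical in
/-- Membership in `thinMembers`. -/
theorem mem_thinMembers {q : ℕ} {G B : Finset α} :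
    B ∈ thinMembers M q G ↔ B ∈ membersIn M (Uq M (q + 2) q) G ∧ B ∉ lay0 M q G := by
  unfold thinMembers; rw [Finset.mem_filter]

/-- The demand is positive for a member inside a rank-`(q+1)` flat. -/
theorem dem_pos {q : ℕ} {G : Finset α} (hG : G ∈ flatsQ M (q + 1)) {B : Finset α}
    (hB : B ∈ membersIn M (Uq M (q + 2) q) G) : 0 < dem M q G B := by
  have hBU : B ∈ Uq M (q + 2) q := (mem_membersIn.1 hB).1
  unfold dem localWeight
  apply mul_pos (phiQ_pos q)
  apply div_pos
  · exact_mod_cast (by have := one_le_card_sdiff_clF hG hBU; omega : 0 < (G \ clF M B).card)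
  · exact_mod_cast (by have := two_le_card_compl_clF hBU; omega : 0 < (gr M \ clF M B).card)

/-- The demand is nonnegative. -/
theorem dem_nonneg (q : ℕ) (G B : Finset α) : 0 ≤ dem M q G B := by
  unfold dem localWeight
  exact mul_nonneg (phiQ_pos q).le (div_nonneg (by positivity) (by positivity))

open scoped Classical in
/-- The `π`-mass is nonnegative for a nonnegative weight. -/
theorem piMass_nonneg {q : ℕ} {G : Finset α} {π : Finset α → ℚ}
    (hπ : ∀ B ∈ thinMembers M q G, 0 ≤ π B) (S : Finset α) : 0 ≤ piMass M q G π S := by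
  unfold piMass
  exact Finset.sum_nonneg (fun B hB => hπ B (Finset.mem_filter.1 hB).1)

open scoped Classical in
/-- The `π`-mass of `S` is at least `π B` for every thin member `B ⊆ S`. -/
theorem le_piMass {q : ℕ} {G : Finset α} {π : Finset α → ℚ}
    (hπ : ∀ B ∈ thinMembers M q G, 0 ≤ π B) {B S : Finset α} (hB : B ∈ thinMembers M q G)
    (hBS : B ⊆ S) : π B ≤ piMass M q G π S := by
  unfold piMass
  exact Finset.single_le_sum (fun B' hB' => hπ B' (Finset.mem_filter.1 hB').1)
    (Finset.mem_filter.2 ⟨hB, hBS⟩)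

open scoped Classical in
/-- The `π`-mass of `S` is positive when a thin member lies below `S` and `π` is positive. -/
theorem piMass_pos {q : ℕ} {G : Finset α} {π : Finset α → ℚ}
    (hπ : ∀ B ∈ thinMembers M q G, 0 < π B) {B S : Finset α} (hB : B ∈ thinMembers M q G)
    (hBS : B ⊆ S) : 0 < piMass M q G π S :=
  lt_of_lt_of_le (hπ B hB) (le_piMass (fun B' hB' => (hπ B' hB').le) hB hBS)

/-- The fair-share income is nonnegative when `|E ∖ G| ≤ q` and `π ≥ 0`. -/
theorem fairIncome_nonneg {q : ℕ} {G : Finset α} (hG : G ∈ flatsQ M (q + 1))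
    (hd : (gr M \ G).card ≤ q) {π : Finset α → ℚ} (hπ : ∀ B ∈ thinMembers M q G, 0 ≤ π B)
    (B : Finset α) : 0 ≤ fairIncome M q G π B := by
  unfold fairIncome
  exact Finset.sum_nonneg (fun S _ => div_nonneg (capS_nonneg' hG hd S) (piMass_nonneg hπ S))

/-- Under the per-member condition the fair-share income of a thin member is positive. -/
theorem fairIncome_pos {q : ℕ} {G : Finset α} (hG : G ∈ flatsQ M (q + 1))
    (hd : (gr M \ G).card ≤ q) {π : Finset α → ℚ} (hπ : ∀ B ∈ thinMembers M q G, 0 < π B)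
    {B : Finset α} (hB : B ∈ thinMembers M q G)
    (hcond : dem M q G B ≤ π B * fairIncome M q G π B) : 0 < fairIncome M q G π B := by
  have h0 : 0 ≤ fairIncome M q G π B := fairIncome_nonneg hG hd (fun B' hB' => (hπ B' hB').le) B
  rcases h0.lt_or_eq with h | h
  · exact h
  · exfalso
    have hdem := dem_pos hG (mem_thinMembers.1 hB).1
    rw [← h, mul_zero] at hcond
    exact absurd hcond (not_le.2 hdem)

/-! ## Nonnegativity and support -/

open scoped Classical in
/-- The fair share is nonnegative. -/
theorem wFair_nonneg {q : ℕ} {G : Finset α} (hG : G ∈ flatsQ M (q + 1)) (hd : (gr M \ G).card ≤ q)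
    {π : Finset α → ℚ} (hπ : ∀ B ∈ thinMembers M q G, 0 ≤ π B) (B S : Finset α) :
    0 ≤ wFair M q G π B S := by
  unfold wFair
  split_ifs with h
  · exact div_nonneg (mul_nonneg (dem_nonneg q G B)
      (div_nonneg (capS_nonneg' hG hd S) (piMass_nonneg hπ S))) (fairIncome_nonneg hG hd hπ B)
  · exact le_refl _

open scoped Classical in
/-- The fair share is supported on containment. -/
theorem subset_of_wFair_ne {q : ℕ} {G : Finset α} {π : Finset α → ℚ} {B S : Finset α}
    (h : wFair M q G π B S ≠ 0) : B ⊆ S := by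
  unfold wFair at h
  split_ifs at h with hc
  · exact (mem_supSets.1 hc.2).2
  · exact absurd rfl h

open scoped Classical in
/-- The rule is supported on containment. -/
theorem subset_of_wFairRule_ne {q : ℕ} {G : Finset α} {π : Finset α → ℚ} {B S : Finset α}
    (h : wFairRule M q G π B S ≠ 0) : B ⊆ S := by
  unfold wFairRule at h
  by_cases h0 : w0 M q G B S = 0
  · rw [h0, zero_add] at h
    exact subset_of_wFair_ne h
  · exact subset_of_w0_ne h0

/-! ## Rows -/

open scoped Classical in
/-- The row sum of the fair share of a thin member is its demand (under the per-member condition). -/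
theorem sum_wFair_row {q : ℕ} {G : Finset α} (hG : G ∈ flatsQ M (q + 1)) (hd : (gr M \ G).card ≤ q)
    {π : Finset α → ℚ} (hπ : ∀ B ∈ thinMembers M q G, 0 < π B) {B : Finset α}
    (hB : B ∈ thinMembers M q G) (hcond : dem M q G B ≤ π B * fairIncome M q G π B) :
    ∑ S ∈ shadowAt M (q + 2) q (Uq M (q + 2) q) G, wFair M q G π B S = dem M q G B := by
  have hN : fairIncome M q G π B ≠ 0 := (fairIncome_pos hG hd hπ hB hcond).ne'
  unfold wFair
  have hcondS : ∀ S, (B ∈ thinMembers M q G ∧ S ∈ supSets M q G B) ↔ S ∈ supSets M q G B :=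
    fun S => ⟨fun h => h.2, fun h => ⟨hB, h⟩⟩
  simp_rw [hcondS]
  rw [← Finset.sum_filter]
  have hsub : supSets M q G B ⊆ shadowAt M (q + 2) q (Uq M (q + 2) q) G :=
    fun S hS => (mem_supSets.1 hS).1
  rw [Finset.filter_mem_eq_inter, Finset.inter_eq_right.2 hsub]
  have hterm : ∀ S ∈ supSets M q G B,
      dem M q G B * (capS M q G S / piMass M q G π S) / fairIncome M q G π B =
      (dem M q G B / fairIncome M q G π B) * (capS M q G S / piMass M q G π S) := by
    intro S _; ring
  rw [Finset.sum_congr rfl hterm, ← Finset.mul_sum]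
  unfold fairIncome at hN ⊢
  field_simp

open scoped Classical in
/-- The fair share of a layer-0 member vanishes. -/
theorem wFair_eq_zero_of_lay0 {q : ℕ} {G : Finset α} {π : Finset α → ℚ} {B : Finset α}
    (hB0 : B ∈ lay0 M q G) (S : Finset α) : wFair M q G π B S = 0 := by
  unfold wFair
  rw [if_neg]
  intro h
  exact (mem_thinMembers.1 h.1).2 hB0

open scoped Classical in
/-- **Rows are exact**: every member receives exactly its local demand. -/
theorem sum_wFairRule_row {q : ℕ} {G : Finset α} (hG : G ∈ flatsQ M (q + 1))
    (hd : (gr M \ G).card ≤ q) {π : Finset α → ℚ} (hπ : ∀ B ∈ thinMembers M q G, 0 < π B)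
    (hcond : ∀ B ∈ thinMembers M q G, dem M q G B ≤ π B * fairIncome M q G π B)
    {B : Finset α} (hB : B ∈ membersIn M (Uq M (q + 2) q) G) :
    ∑ S ∈ shadowAt M (q + 2) q (Uq M (q + 2) q) G, wFairRule M q G π B S =
      phiQ q * localWeight M B G := by
  have hBU : B ∈ Uq M (q + 2) q := (mem_membersIn.1 hB).1
  have hBG : clF M B ⊆ G := (mem_membersIn.1 hB).2
  unfold wFairRule
  rw [Finset.sum_add_distrib]
  by_cases hB0 : B ∈ lay0 M q G
  · rw [sum_w0_row_lay0 hG hB0]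
    have hz : ∑ S ∈ shadowAt M (q + 2) q (Uq M (q + 2) q) G, wFair M q G π B S = 0 :=
      Finset.sum_eq_zero (fun S _ => wFair_eq_zero_of_lay0 hB0 S)
    rw [hz, add_zero]
    have hc : ((gr M \ clF M B).card : ℚ) = ((G \ clF M B).card : ℚ) + ((gr M \ G).card : ℚ) := by
      rw [card_compl_clF_add hG hBG]; push_cast; ring
    unfold localWeight
    rw [(mem_lay0.1 hB0).2.1, hc, (mem_lay0.1 hB0).2.1]
    push_cast
    ring
  · have hBt : B ∈ thinMembers M q G := mem_thinMembers.2 ⟨hB, hB0⟩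
    have hz0 : ∑ S ∈ shadowAt M (q + 2) q (Uq M (q + 2) q) G, w0 M q G B S = 0 := by
      apply Finset.sum_eq_zero
      intro S _
      unfold w0
      rw [if_neg]
      intro h; exact hB0 h.1
    rw [hz0, zero_add, sum_wFair_row hG hd hπ hBt (hcond B hBt)]
    rfl

/-! ## Columns -/

open scoped Classical in
/-- The fair-share column sum at `S` is `(capS S / piMass π S) · Σ_{B thin ⊆ S} dem B / fairIncome π B`. -/
theorem sum_wFair_col (q : ℕ) (G : Finset α) (π : Finset α → ℚ) {S : Finset α}
    (hS : S ∈ shadowAt M (q + 2) q (Uq M (q + 2) q) G) :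
    ∑ B ∈ membersIn M (Uq M (q + 2) q) G, wFair M q G π B S =
      (capS M q G S / piMass M q G π S) *
        ∑ B ∈ (thinMembers M q G).filter (fun B => B ⊆ S), dem M q G B / fairIncome M q G π B := by
  unfold wFair
  rw [← Finset.sum_filter, Finset.mul_sum]
  have hset : (membersIn M (Uq M (q + 2) q) G).filter
      (fun B => B ∈ thinMembers M q G ∧ S ∈ supSets M q G B) =
      (thinMembers M q G).filter (fun B => B ⊆ S) := by
    ext B
    rw [Finset.mem_filter, Finset.mem_filter, mem_supSets, mem_thinMembers]
    constructor
    · rintro ⟨hB, ⟨-, hB0⟩, -, hBS⟩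
      exact ⟨⟨hB, hB0⟩, hBS⟩
    · rintro ⟨⟨hB, hB0⟩, hBS⟩
      exact ⟨hB, ⟨hB, hB0⟩, hS, hBS⟩
  rw [hset]
  apply Finset.sum_congr rfl
  intro B _
  ring

open scoped Classical in
/-- **The column bound**: under the per-member condition the fair-share column sum at `S` is at most `capS S`. -/
theorem sum_wFair_col_le {q : ℕ} {G : Finset α} (hG : G ∈ flatsQ M (q + 1))
    (hd : (gr M \ G).card ≤ q) {π : Finset α → ℚ} (hπ : ∀ B ∈ thinMembers M q G, 0 < π B)
    (hcond : ∀ B ∈ thinMembers M q G, dem M q G B ≤ π B * fairIncome M q G π B)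
    {S : Finset α} (hS : S ∈ shadowAt M (q + 2) q (Uq M (q + 2) q) G) :
    ∑ B ∈ membersIn M (Uq M (q + 2) q) G, wFair M q G π B S ≤ capS M q G S := by
  rw [sum_wFair_col q G π hS]
  have hπ' : ∀ B ∈ thinMembers M q G, 0 ≤ π B := fun B hB => (hπ B hB).le
  by_cases hne : ((thinMembers M q G).filter (fun B => B ⊆ S)).Nonempty
  · obtain ⟨B₀, hB₀⟩ := hne
    rw [Finset.mem_filter] at hB₀
    have hPi : 0 < piMass M q G π S := piMass_pos hπ hB₀.1 hB₀.2
    have hcap : 0 ≤ capS M q G S := capS_nonneg' hG hd S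
    -- each term dem B / fairIncome B ≤ π B
    have hterm : ∀ B ∈ (thinMembers M q G).filter (fun B => B ⊆ S),
        dem M q G B / fairIncome M q G π B ≤ π B := by
      intro B hB
      have hBt : B ∈ thinMembers M q G := (Finset.mem_filter.1 hB).1
      have hN : 0 < fairIncome M q G π B := fairIncome_pos hG hd hπ hBt (hcond B hBt)
      rw [div_le_iff₀ hN]
      exact hcond B hBt
    calc (capS M q G S / piMass M q G π S) *
          ∑ B ∈ (thinMembers M q G).filter (fun B => B ⊆ S), dem M q G B / fairIncome M q G π B
        ≤ (capS M q G S / piMass M q G π S) *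
          ∑ B ∈ (thinMembers M q G).filter (fun B => B ⊆ S), π B :=
          mul_le_mul_of_nonneg_left (Finset.sum_le_sum hterm) (div_nonneg hcap hPi.le)
      _ = capS M q G S := by
          unfold piMass at hPi ⊢
          rw [div_mul_eq_mul_div, mul_div_assoc, div_self hPi.ne', mul_one]
  · rw [Finset.not_nonempty_iff_eq_empty] at hne
    rw [hne, Finset.sum_empty, mul_zero]
    exact capS_nonneg' hG hd S

open scoped Classical in
/-- The column sum of the fair-share rule at `S` is at most `1`. -/
theorem sum_wFairRule_col_le {q : ℕ} {G : Finset α} (hG : G ∈ flatsQ M (q + 1))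
    (hd : (gr M \ G).card ≤ q) {π : Finset α → ℚ} (hπ : ∀ B ∈ thinMembers M q G, 0 < π B)
    (hcond : ∀ B ∈ thinMembers M q G, dem M q G B ≤ π B * fairIncome M q G π B)
    {S : Finset α} (hS : S ∈ shadowAt M (q + 2) q (Uq M (q + 2) q) G) :
    ∑ B ∈ membersIn M (Uq M (q + 2) q) G, wFairRule M q G π B S ≤ 1 := by
  unfold wFairRule
  rw [Finset.sum_add_distrib, sum_w0_col]
  have h := sum_wFair_col_le hG hd hπ hcond hS
  unfold capS at h
  have e : (k1 M q G S : ℚ) * (phiQ q / (1 + ((gr M \ G).card : ℚ))) =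
      (k1 M q G S : ℚ) * phiQ q / (1 + ((gr M \ G).card : ℚ)) := by ring
  rw [e]
  linarith

/-! ## The certificate -/

open scoped Classical in
/-- **The local form from the fair-share rule.**  With `|E ∖ G| ≤ q` and a positive weight `π` on the thin
members, if every thin member `B` satisfies `dem B ≤ π B · fairIncome π B`, then (LI_G) holds at `G`. -/
theorem localShadowHall_of_fairShare {q : ℕ} {G : Finset α} (hG : G ∈ flatsQ M (q + 1))
    (hd : (gr M \ G).card ≤ q) (π : Finset α → ℚ) (hπ : ∀ B ∈ thinMembers M q G, 0 < π B)
    (hcond : ∀ B ∈ thinMembers M q G, dem M q G B ≤ π B * fairIncome M q G π B) :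
    LocalShadowHall M q G := by
  apply localShadowHall_of_full_matching (wFairRule M q G π)
  · intro B S
    unfold wFairRule
    exact add_nonneg (w0_nonneg q G B S) (wFair_nonneg hG hd (fun B' hB' => (hπ B' hB').le) B S)
  · exact fun B S h => subset_of_wFairRule_ne h
  · exact fun S hS => sum_wFairRule_col_le hG hd hπ hcond hS
  · intro B hB
    rw [sum_wFairRule_row hG hd hπ hcond hB]
    exact le_refl _

/-! ## The instance `π B = dem B / #supSets B` -/

/-- The π-normalised weight: the demand of `B` divided by its number of spanning supersets. -/
noncomputable def piDem (M : Matroid α) [M.Finite] (q : ℕ) (G B : Finset α) : ℚ :=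
  dem M q G B / ((supSets M q G B).card : ℚ)

open scoped Classical in
/-- Every member has a spanning superset (its covering sets), so `#supSets B ≥ 1`. -/
theorem supSets_nonempty {q : ℕ} {G : Finset α} (hG : G ∈ flatsQ M (q + 1)) {B : Finset α}
    (hB : B ∈ membersIn M (Uq M (q + 2) q) G) : (supSets M q G B).Nonempty := by
  have hBU : B ∈ Uq M (q + 2) q := (mem_membersIn.1 hB).1
  have h1 := one_le_card_sdiff_clF hG hBU
  obtain ⟨z, hz⟩ := Finset.card_pos.1 (by omega : 0 < (G \ clF M B).card)
  refine ⟨insert z B, mem_supSets.2 ⟨?_, Finset.subset_insert _ _⟩⟩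
  exact coverSets_subset_shadowAt (Finset.Subset.refl _) hG hB (mem_coverSets.2 ⟨z, hz, rfl⟩)

/-- The π-normalised weight is positive on the members. -/
theorem piDem_pos {q : ℕ} {G : Finset α} (hG : G ∈ flatsQ M (q + 1)) {B : Finset α}
    (hB : B ∈ membersIn M (Uq M (q + 2) q) G) : 0 < piDem M q G B := by
  unfold piDem
  apply div_pos (dem_pos hG hB)
  exact_mod_cast Finset.card_pos.2 (supSets_nonempty hG hB)

open scoped Classical in
/-- **The local form from the π-normalised fair-share rule.**  With `|E ∖ G| ≤ q`, if for every thin member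
`B` the average over its spanning supersets `S` of `capS S / piMass piDem S` is at least `1`, i.e.
`#supSets B ≤ fairIncome piDem B`, then (LI_G) holds at `G`. -/
theorem localShadowHall_of_fairShare_dem {q : ℕ} {G : Finset α} (hG : G ∈ flatsQ M (q + 1))
    (hd : (gr M \ G).card ≤ q)
    (hcond : ∀ B ∈ thinMembers M q G,
      ((supSets M q G B).card : ℚ) ≤ fairIncome M q G (piDem M q G) B) :
    LocalShadowHall M q G := by
  apply localShadowHall_of_fairShare hG hd (piDem M q G)
  · exact fun B hB => piDem_pos hG (mem_thinMembers.1 hB).1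
  · intro B hB
    have hB' : B ∈ membersIn M (Uq M (q + 2) q) G := (mem_thinMembers.1 hB).1
    have hT : (0 : ℚ) < ((supSets M q G B).card : ℚ) := by
      exact_mod_cast Finset.card_pos.2 (supSets_nonempty hG hB')
    have h := hcond B hB
    unfold piDem
    rw [div_mul_eq_mul_div, le_div_iff₀ hT]
    exact mul_le_mul_of_nonneg_left h (dem_nonneg q G B)

end PercRepro.Shadow
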